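import Literature.Geometry.Kaehler.ComplexTorusFirstCohomologyHodgeLieAlgebraBridge
import Literature.Geometry.Kaehler.ComplexTorusAbelianFivefoldConditionD
import HarnessLib

/-!
# Moonen–Zarhin 1999 (2.6) ∕ Thm. (2.7) (Tankeev, Ribet) at `g = 5`, WITH TYPE I(1): every SIMPLE complex abelian FIVEFOLD
# outside the single residual class IV(1) with multiplicities `(3,2)` satisfies `ℬ•(Xⁿ) = 𝒟•(Xⁿ)` for all `n` and
# `Hg(X) = Lf(X) = S(X)` («`Hg(X) = Sp_D(V,φ)`»); and Thm. (0.2) (4) in dimension `5` with the simple side so reduced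

Layer `Literature/Geometry/Kaehler`, namespace `Literature.Geometry.Kaehler.ComplexTorus`; lane `lit-hodgefound` (Track 2
foundations library), Layer A4, prover seat `lit-hodgefound-p17` (generation 58), self-proposed row g58-#2 — the DISPATCH of
✔ gen-56 `ComplexTorusSimpleAbelianFivefoldFourCases` §3 with its type-I(1) hypothesis `End⁰(X) ≠ ℚ` REMOVED by g58-#1
(`ComplexTorusFirstCohomologyHodgeLieAlgebraBridge` §4: `End_ℚ(X) = ℚ`, `g = 5` ⟹ `Hg(X) = Sp(V, E)`, `ℬ•(Xⁿ) = 𝒟•(Xⁿ)` — the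
Lie-level carrier bridge `H₁ ↔ H¹` and the tree's rank-ten Θ-subalgebra theorem), and the corresponding sharpening of ✔ gen-56
`ComplexTorusAbelianFivefoldConditionD` (Thm. (0.2) (4) in one statement).  THEOREMS ONLY (no definition, no instance, no
notation, no named fact; D-0026, net debt 0); the twin at `g = 3` is the seat's `ComplexTorusSimpleAbelianThreefoldStablyNondegenerate`.

## Sources, VERBATIM (held `paper:arxiv-math_9901113`; `p0NNN Lnn` = chunk file and line of the materialised text)

B. J. J. Moonen, Yu. G. Zarhin [MoonenZarhin1999LowDim], *Hodge classes on abelian varieties of low dimension*, Math. Ann. 315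
(1999): §2 (p0005 L19–L22) «For `g := dim(X) ≤ 3` and `g = 5` we always find that `Hg(X) = Sp_D(V,φ)`. Since type 3 does not
occur for `g ≤ 3` and `g = 5` (`X` simple!), it follows that `ℬ•(Xⁿ) = 𝒟•(Xⁿ)` for all `n`»; (2.6) (p0006 L2–L5) «`g = 5`. As
already stated above, `Hg(X) = Sp_D(V,φ)` for all simple abelian 5-folds. The point here is that 5 is a prime number, since in
fact we have the following result, due to Tankeev. (See also Ribet's paper.)»; Thm. (2.7) (p0006 L9–L11) «Let `X` be a simple
complex abelian variety such that `dim(X)` is a prime number. Then `Hg(X) = Sp_D(V,φ)` and `ℬ•(Xⁿ) = 𝒟•(Xⁿ)` for every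
`n ≥ 1`.»; Thm. (0.2) (4) (p0002 L5–L8) «Suppose we are not in one of the cases (e), (f) or (g). Then … In particular, if `X`
has no simple factor of dimension 4 then `Hg(X) = Sp_D(V,φ)` and `ℬ•(Xⁿ) = 𝒟•(Xⁿ)` for every `n ≥ 1`».
B. B. Gordon [Gordon1997], *A survey of the Hodge conjecture for abelian varieties*, 1.13.3 (simple abelian varieties of odd
prime dimension: «`End⁰A ≃ ℚ`, which is the general case; or … totally real … of degree `g`; or … imaginary quadratic …; or
CM-type»), Thm. 6.3 and Corollary («When `A` is a simple abelian variety of prime dimension, then `Hdg(Aⁿ) = Div(Aⁿ)` for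
`n ≥ 1`»).

## What is proved (`X` a SIMPLE polarised complex torus of dimension `5`; the one hypothesis is `h2`: no complex embedding of
the centre of `End⁰(X)` has tangent multiplicity `2` — it excludes exactly type IV(1) with multiplicities `(3,2)`)

* §1 **`IsSimple.forall_divisorClasses_powPeriod_eq_hodgeClasses_of_finrank_eq_five_of_forall_ne_two`** — `ℬ•(Xᵏ) = 𝒟•(Xᵏ)`
  for all `k, p` (type I(1) by g58-#1; types I(5), IV(5,·), IV(1) `(4,1)` by gen-56's four-cases theorem);
  `IsSimple.hodgeGroupC_eq_lefschetzIdentityC_of_finrank_eq_five_of_forall_ne_two` (`Hg(X)(ℂ) = Lf(X)(ℂ)`),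
  `IsSimple.hodgeGroupC_eq_lefschetzGroupC_of_finrank_eq_five_of_forall_ne_two` (`= S(X)(ℂ)`),
  **`IsSimple.hodgeGroup_eq_lefschetzGroup_of_finrank_eq_five_of_forall_ne_two`** («`Hg(X) = Sp_D(V,φ)`», real points),
  and the polarisation-free form `IsAbelianVariety.…`.
* §2 **`IsRiemannForm.forall_divisorClasses_powPeriod_eq_hodgeClasses_of_finrank_eq_five_of_forall_not_isIsogenous_of_forall_isEmpty_of_forall_ne_two`**
  — Thm. (0.2) (4) in dimension `5` in one statement, the simple-side hypothesis of gen-56's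
  `…_of_isSimple_imp` reduced from «`End⁰(X) ≠ ℚ` and no multiplicity `2`» to «no multiplicity `2`»; the `Hg(X) = Lf(X)` and
  isogeny forms.
  `-- TODO(general form): the last residual simple case, type IV(1) with multiplicities (3,2) (Gabber's prime-dimension`
  `-- theorem ∕ the tree's Motives (2,3) Θ-subalgebra theorem, once the multiplicity dictionary H¹ ↔ tangent space is in place).`
-/

noncomputable section

open scoped Matrix
open Module Matrix NormedSpace NumberField

namespace Literature.Geometry.Kaehler

namespace ComplexTorus

/-! ## §1 Every simple fivefold outside IV(1) `(3,2)`: `ℬ•(Xⁿ) = 𝒟•(Xⁿ)`, `Hg(X) = Lf(X) = S(X)` -/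

section Simple

variable {κ : Type} [Fintype κ] [DecidableEq κ] [Nonempty κ] {E : Type} [NormedAddCommGroup E] [NormedSpace ℂ E]
  [FiniteDimensional ℂ E] {Ψ : (κ → ℝ) ≃L[ℝ] E} {η : E [⋀^Fin 2]→L[ℝ] ℝ}

/-- **MOONEN–ZARHIN (2.6) ∕ THM. (2.7) (TANKEEV, RIBET) AT `g = 5`, ALL CASES BUT ONE: a SIMPLE polarised complex abelian
FIVEFOLD none of whose centre embeddings has tangent multiplicity `2` satisfies `ℬ•(Xᵏ) = 𝒟•(Xᵏ)` for all `k, p`** — type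
I(1) (`End⁰(X) = ℚ`: g58-#1, the rank-ten Θ-subalgebra theorem transported to the torus), I(5), IV(5,·), IV(1) `(4,1)`
(gen-56's four cases).  The residual IV(1) `(3,2)` is the hypothesis `h2`. [cite: MoonenZarhin1999LowDim, §2 (p0005 L19–L22), (2.6) and Thm. (2.7) (p0006 L2–L11)]
[cite: Gordon1997, 1.13.3, Thm. 6.3 and Corollary] [cite: Ribet1983, Thms. 1–3] -/
theorem IsSimple.forall_divisorClasses_powPeriod_eq_hodgeClasses_of_finrank_eq_five_of_forall_ne_two (hX : IsSimple Ψ)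
    (hη : IsRiemannForm Ψ η) (h5 : finrank ℂ E = 5)
    (h2 : ∀ σ : centerField Ψ hX →+* ℂ, finrank ℂ ↥(⨅ y : centerField Ψ hX, Module.End.eigenspace
      ((analyticRepHom Ψ ⟨centerField.valAlgHom Ψ hX y, centerField.val_mem Ψ hX y⟩ : E →L[ℂ] E) : E →ₗ[ℂ] E) (σ y)) ≠ 2) :
    ∀ k p : ℕ, divisorClasses (powPeriod Ψ k) p = hodgeClasses (powPeriod Ψ k) p := by
  by_cases hE : endAlgRat Ψ = ⊥
  · exact hη.forall_divisorClasses_eq_hodgeClasses_powPeriod_of_finrank_eq_five_of_endAlgRat_eq_bot h5 hE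
  · exact hX.forall_divisorClasses_powPeriod_eq_hodgeClasses_of_finrank_eq_five_of_endAlgRat_ne_bot_of_forall_ne_two hη h5
      hE h2

/-- The polarisation-free form: **a simple abelian fivefold none of whose centre embeddings has tangent multiplicity `2`
satisfies `ℬ•(Xᵏ) = 𝒟•(Xᵏ)` for all `k, p`.** [cite: MoonenZarhin1999LowDim, §2 (2.6) and Thm. (2.7)] [cite: Gordon1997, Thm. 6.3 and Corollary] -/
theorem IsAbelianVariety.forall_divisorClasses_powPeriod_eq_hodgeClasses_of_isSimple_of_finrank_eq_five_of_forall_ne_two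
    (hA : IsAbelianVariety Ψ) (hX : IsSimple Ψ) (h5 : finrank ℂ E = 5)
    (h2 : ∀ σ : centerField Ψ hX →+* ℂ, finrank ℂ ↥(⨅ y : centerField Ψ hX, Module.End.eigenspace
      ((analyticRepHom Ψ ⟨centerField.valAlgHom Ψ hX y, centerField.val_mem Ψ hX y⟩ : E →L[ℂ] E) : E →ₗ[ℂ] E) (σ y)) ≠ 2) :
    ∀ k p : ℕ, divisorClasses (powPeriod Ψ k) p = hodgeClasses (powPeriod Ψ k) p := by
  obtain ⟨η, hη⟩ := hA
  exact hX.forall_divisorClasses_powPeriod_eq_hodgeClasses_of_finrank_eq_five_of_forall_ne_two hη h5 h2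

/-- **`Hg(X)(ℂ) = Lf(X)(ℂ)`** for the same simple fivefolds. [cite: MoonenZarhin1999LowDim, §2 (2.6) and Thm. (2.7)]
[cite: Milne1999LefschetzClasses, §4 Prop. 4.8] [cite: Gordon1997, Thm. 7.5] -/
theorem IsSimple.hodgeGroupC_eq_lefschetzIdentityC_of_finrank_eq_five_of_forall_ne_two (hX : IsSimple Ψ)
    (hη : IsRiemannForm Ψ η) {G : Matrix κ κ ℚ} (hG : G.map (Rat.cast : ℚ → ℝ) = latticeGram Ψ η) (h5 : finrank ℂ E = 5)
    (h2 : ∀ σ : centerField Ψ hX →+* ℂ, finrank ℂ ↥(⨅ y : centerField Ψ hX, Module.End.eigenspace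
      ((analyticRepHom Ψ ⟨centerField.valAlgHom Ψ hX y, centerField.val_mem Ψ hX y⟩ : E →L[ℂ] E) : E →ₗ[ℂ] E) (σ y)) ≠ 2) :
    hodgeGroupC Ψ = lefschetzIdentityC Ψ G :=
  ((hη.forall_divisorClasses_powPeriod_eq_hodgeClasses_iff_eq_and_hodgeGroupC_eq_lefschetzIdentityC hG (by omega)).1
    (hX.forall_divisorClasses_powPeriod_eq_hodgeClasses_of_finrank_eq_five_of_forall_ne_two hη h5 h2)).2

/-- **`Lf(X)(ℂ) = S(X)(ℂ)` and `Hg(X)(ℂ) = S(X)(ℂ)`** for the same simple fivefolds («type 3 does not occur for `g = 5`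
(`X` simple!)»). [cite: MoonenZarhin1999LowDim, §2 (p0005 L20–L21)] [cite: Milne1999LefschetzClasses, §2 Summary table and §4 Prop. 4.8] -/
theorem IsSimple.hodgeGroupC_eq_lefschetzGroupC_of_finrank_eq_five_of_forall_ne_two (hX : IsSimple Ψ)
    (hη : IsRiemannForm Ψ η) {G : Matrix κ κ ℚ} (hG : G.map (Rat.cast : ℚ → ℝ) = latticeGram Ψ η) (h5 : finrank ℂ E = 5)
    (h2 : ∀ σ : centerField Ψ hX →+* ℂ, finrank ℂ ↥(⨅ y : centerField Ψ hX, Module.End.eigenspace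
      ((analyticRepHom Ψ ⟨centerField.valAlgHom Ψ hX y, centerField.val_mem Ψ hX y⟩ : E →L[ℂ] E) : E →ₗ[ℂ] E) (σ y)) ≠ 2) :
    hodgeGroupC Ψ = lefschetzGroupC Ψ G := by
  have h := (hη.forall_divisorClasses_powPeriod_eq_hodgeClasses_iff_eq_and_hodgeGroupC_eq_lefschetzIdentityC hG (by omega)).1
    (hX.forall_divisorClasses_powPeriod_eq_hodgeClasses_of_finrank_eq_five_of_forall_ne_two hη h5 h2)
  rw [h.2, h.1]

/-- **«`Hg(X) = Sp_D(V,φ)`» ON REAL POINTS: `Hg(X)(ℝ) = S(X)(ℝ)`** for every simple polarised fivefold outside IV(1) `(3,2)`.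
[cite: MoonenZarhin1999LowDim, §2 (2.6) («`Hg(X) = Sp_D(V,φ)` for all simple abelian 5-folds») and Thm. (2.7)] [cite: Milne1999LefschetzClasses, §4 Prop. 4.8] -/
theorem IsSimple.hodgeGroup_eq_lefschetzGroup_of_finrank_eq_five_of_forall_ne_two (hX : IsSimple Ψ) (hη : IsRiemannForm Ψ η)
    (h5 : finrank ℂ E = 5)
    (h2 : ∀ σ : centerField Ψ hX →+* ℂ, finrank ℂ ↥(⨅ y : centerField Ψ hX, Module.End.eigenspace
      ((analyticRepHom Ψ ⟨centerField.valAlgHom Ψ hX y, centerField.val_mem Ψ hX y⟩ : E →L[ℂ] E) : E →ₗ[ℂ] E) (σ y)) ≠ 2) :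
    hodgeGroup Ψ = lefschetzGroup Ψ η := by
  obtain ⟨G, hG⟩ := hη.exists_ratMatrix_latticeGram
  exact ((hη.forall_divisorClasses_powPeriod_eq_hodgeClasses_iff_eq_and_hodgeGroup_eq_lefschetzGroup hG (by omega)).1
    (hX.forall_divisorClasses_powPeriod_eq_hodgeClasses_of_finrank_eq_five_of_forall_ne_two hη h5 h2)).2

end Simple

/-! ## §2 Thm. (0.2) (4) in dimension 5, one statement, with only IV(1) `(3,2)` excluded on the simple side -/

section Fivefold

variable {κ : Type} [Fintype κ] [DecidableEq κ] [Nonempty κ] {E : Type} [NormedAddCommGroup E] [NormedSpace ℂ E]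
  [FiniteDimensional ℂ E] {Ψ : (κ → ℝ) ≃L[ℝ] E} {η : E [⋀^Fin 2]→L[ℝ] ℝ}

/-- **MOONEN–ZARHIN 1999 IN DIMENSION 5, ONE STATEMENT (type I(1) now included): `ℬ•(Xᵏ) = 𝒟•(Xᵏ)` for all `k, p`** for a
polarised complex abelian fivefold `X` which (if non-simple) has no simple fourfold isogeny factor and is not of the forms
(e) ∕ (f), and (if simple) has no centre embedding of tangent multiplicity `2` — Thm. (0.2) (4) («if `X` has no simple factor
of dimension 4 then … `ℬ•(Xⁿ) = 𝒟•(Xⁿ)` for every `n ≥ 1`», ✔ g55-#13) with (2.6) ∕ Thm. (2.7) at `g = 5` (§1).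
[cite: MoonenZarhin1999LowDim, Thm. (0.2) (4) (p0002 L1–L8), §2 (p0005 L19–L22), (2.6) and Thm. (2.7) (p0006 L2–L11)]
[cite: Gordon1997, 1.13.3, Thm. 6.3 and Corollary] -/
theorem IsRiemannForm.forall_divisorClasses_powPeriod_eq_hodgeClasses_of_finrank_eq_five_of_forall_not_isIsogenous_of_forall_isEmpty_of_forall_ne_two
    (hη : IsRiemannForm Ψ η) (h5 : finrank ℂ E = 5)
    (h4 : ∀ {κ' : Type} [Fintype κ'] [DecidableEq κ'] {E' : Type} [NormedAddCommGroup E'] [NormedSpace ℂ E']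
      [FiniteDimensional ℂ E'] {Ψ' : (κ' → ℝ) ≃L[ℝ] E'} {η' : E' [⋀^Fin 2]→L[ℝ] ℝ}, IsRiemannForm Ψ' η' →
      finrank ℂ E' = 4 → IsSimple Ψ' → ∀ {τ : ℂ} (hτ : τ.im ≠ 0), ¬ IsIsogenous Ψ (prodPeriod Ψ' (ellipticPeriod hτ)))
    (hef : ∀ {κ' : Type} [Fintype κ'] [DecidableEq κ'] {E' : Type} [NormedAddCommGroup E'] [NormedSpace ℂ E']
      [FiniteDimensional ℂ E'] {Ψ' : (κ' → ℝ) ≃L[ℝ] E'} {η' : E' [⋀^Fin 2]→L[ℝ] ℝ}, IsRiemannForm Ψ' η' →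
      finrank ℂ E' = 3 → IsSimple Ψ' → ∀ {σ : ℂ} (hσ : σ.im ≠ 0) {ρ : ℂ} (hρ : ρ.im ≠ 0),
      IsIsogenous Ψ (prodPeriod (prodPeriod Ψ' (ellipticPeriod hσ)) (ellipticPeriod hρ)) → ellipticEnd hρ ≠ ⊥ →
      IsEmpty (Algebra.adjoin ℚ {ρ} →ₐ[ℚ] endAlgRat Ψ'))
    (hS : ∀ hX : IsSimple Ψ, ∀ σ : centerField Ψ hX →+* ℂ, finrank ℂ ↥(⨅ y : centerField Ψ hX,
      Module.End.eigenspace ((analyticRepHom Ψ ⟨centerField.valAlgHom Ψ hX y, centerField.val_mem Ψ hX y⟩ : E →L[ℂ] E) :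
        E →ₗ[ℂ] E) (σ y)) ≠ 2) :
    ∀ k p, divisorClasses (powPeriod Ψ k) p = hodgeClasses (powPeriod Ψ k) p := by
  by_cases hX : IsSimple Ψ
  · exact hX.forall_divisorClasses_powPeriod_eq_hodgeClasses_of_finrank_eq_five_of_forall_ne_two hη h5 (hS hX)
  · exact hη.forall_divisorClasses_powPeriod_eq_hodgeClasses_of_not_isSimple_of_finrank_eq_five_of_forall_not_isIsogenous_of_forall_isEmpty
      h5 hX h4 hef

/-- **«`Hg(X) = Sp_D(V,φ)`» for the same fivefolds** (real points: `Hg(X)(ℝ) = S(X)(ℝ)`), from (D) by Gordon's Thm. 7.5 (1) ⟹ (2).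
[cite: MoonenZarhin1999LowDim, Thm. (0.2) (4) (p0002 L5–L8) and §2 (2.6)] [cite: Gordon1999HodgeAVSurvey, Thm. 7.5 (1) ⟺ (2)]
[cite: Milne1999LefschetzClasses, §4 Prop. 4.8] -/
theorem IsRiemannForm.hodgeGroup_eq_lefschetzGroup_of_finrank_eq_five_of_forall_not_isIsogenous_of_forall_isEmpty_of_forall_ne_two
    (hη : IsRiemannForm Ψ η) (h5 : finrank ℂ E = 5)
    (h4 : ∀ {κ' : Type} [Fintype κ'] [DecidableEq κ'] {E' : Type} [NormedAddCommGroup E'] [NormedSpace ℂ E']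
      [FiniteDimensional ℂ E'] {Ψ' : (κ' → ℝ) ≃L[ℝ] E'} {η' : E' [⋀^Fin 2]→L[ℝ] ℝ}, IsRiemannForm Ψ' η' →
      finrank ℂ E' = 4 → IsSimple Ψ' → ∀ {τ : ℂ} (hτ : τ.im ≠ 0), ¬ IsIsogenous Ψ (prodPeriod Ψ' (ellipticPeriod hτ)))
    (hef : ∀ {κ' : Type} [Fintype κ'] [DecidableEq κ'] {E' : Type} [NormedAddCommGroup E'] [NormedSpace ℂ E']
      [FiniteDimensional ℂ E'] {Ψ' : (κ' → ℝ) ≃L[ℝ] E'} {η' : E' [⋀^Fin 2]→L[ℝ] ℝ}, IsRiemannForm Ψ' η' →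
      finrank ℂ E' = 3 → IsSimple Ψ' → ∀ {σ : ℂ} (hσ : σ.im ≠ 0) {ρ : ℂ} (hρ : ρ.im ≠ 0),
      IsIsogenous Ψ (prodPeriod (prodPeriod Ψ' (ellipticPeriod hσ)) (ellipticPeriod hρ)) → ellipticEnd hρ ≠ ⊥ →
      IsEmpty (Algebra.adjoin ℚ {ρ} →ₐ[ℚ] endAlgRat Ψ'))
    (hS : ∀ hX : IsSimple Ψ, ∀ σ : centerField Ψ hX →+* ℂ, finrank ℂ ↥(⨅ y : centerField Ψ hX,
      Module.End.eigenspace ((analyticRepHom Ψ ⟨centerField.valAlgHom Ψ hX y, centerField.val_mem Ψ hX y⟩ : E →L[ℂ] E) :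
        E →ₗ[ℂ] E) (σ y)) ≠ 2) :
    hodgeGroup Ψ = lefschetzGroup Ψ η := by
  obtain ⟨G, hG⟩ := hη.exists_ratMatrix_latticeGram
  exact ((hη.forall_divisorClasses_powPeriod_eq_hodgeClasses_iff_eq_and_hodgeGroup_eq_lefschetzGroup hG (by omega)).1
    (hη.forall_divisorClasses_powPeriod_eq_hodgeClasses_of_finrank_eq_five_of_forall_not_isIsogenous_of_forall_isEmpty_of_forall_ne_two
      h5 h4 hef hS)).2

end Fivefold

section FivefoldIsogenous

variable {ι : Type*} [Fintype ι] [DecidableEq ι] {F : Type*} [NormedAddCommGroup F] [NormedSpace ℂ F] {Φ : (ι → ℝ) ≃L[ℝ] F}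
  {κ : Type} [Fintype κ] [DecidableEq κ] [Nonempty κ] {E : Type} [NormedAddCommGroup E] [NormedSpace ℂ E]
  [FiniteDimensional ℂ E] {Ψ : (κ → ℝ) ≃L[ℝ] E} {η : E [⋀^Fin 2]→L[ℝ] ℝ}

/-- **Every complex torus isogenous to such a fivefold satisfies (D).**
[cite: MoonenZarhin1999LowDim, Thm. (0.2) (4) (p0002 L1–L8) and §2 (2.6)] [cite: Lange2023AbelianVarietiesComplex, §1.1.2 Cor. 1.1.16] -/
theorem IsIsogenous.forall_divisorClasses_powPeriod_eq_hodgeClasses_of_finrank_eq_five_of_forall_not_isIsogenous_of_forall_isEmpty_of_forall_ne_two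
    (hiso : IsIsogenous Φ Ψ) (hη : IsRiemannForm Ψ η) (h5 : finrank ℂ E = 5)
    (h4 : ∀ {κ' : Type} [Fintype κ'] [DecidableEq κ'] {E' : Type} [NormedAddCommGroup E'] [NormedSpace ℂ E']
      [FiniteDimensional ℂ E'] {Ψ' : (κ' → ℝ) ≃L[ℝ] E'} {η' : E' [⋀^Fin 2]→L[ℝ] ℝ}, IsRiemannForm Ψ' η' →
      finrank ℂ E' = 4 → IsSimple Ψ' → ∀ {τ : ℂ} (hτ : τ.im ≠ 0), ¬ IsIsogenous Ψ (prodPeriod Ψ' (ellipticPeriod hτ)))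
    (hef : ∀ {κ' : Type} [Fintype κ'] [DecidableEq κ'] {E' : Type} [NormedAddCommGroup E'] [NormedSpace ℂ E']
      [FiniteDimensional ℂ E'] {Ψ' : (κ' → ℝ) ≃L[ℝ] E'} {η' : E' [⋀^Fin 2]→L[ℝ] ℝ}, IsRiemannForm Ψ' η' →
      finrank ℂ E' = 3 → IsSimple Ψ' → ∀ {σ : ℂ} (hσ : σ.im ≠ 0) {ρ : ℂ} (hρ : ρ.im ≠ 0),
      IsIsogenous Ψ (prodPeriod (prodPeriod Ψ' (ellipticPeriod hσ)) (ellipticPeriod hρ)) → ellipticEnd hρ ≠ ⊥ →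
      IsEmpty (Algebra.adjoin ℚ {ρ} →ₐ[ℚ] endAlgRat Ψ'))
    (hS : ∀ hX : IsSimple Ψ, ∀ σ : centerField Ψ hX →+* ℂ, finrank ℂ ↥(⨅ y : centerField Ψ hX,
      Module.End.eigenspace ((analyticRepHom Ψ ⟨centerField.valAlgHom Ψ hX y, centerField.val_mem Ψ hX y⟩ : E →L[ℂ] E) :
        E →ₗ[ℂ] E) (σ y)) ≠ 2) :
    ∀ k p, divisorClasses (powPeriod Φ k) p = hodgeClasses (powPeriod Φ k) p :=
  hiso.forall_powPeriod_divisorClasses_eq_hodgeClasses_iff.2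
    (hη.forall_divisorClasses_powPeriod_eq_hodgeClasses_of_finrank_eq_five_of_forall_not_isIsogenous_of_forall_isEmpty_of_forall_ne_two
      h5 h4 hef hS)

end FivefoldIsogenous

end ComplexTorus

end Literature.Geometry.Kaehler
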